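import Summits.Schanuel.Schanuel.Theorems.RootDecomp1KRadical03

/-!
# RootDecomp1KRadical («RADICAL CELLS», lens 6 gen 11) — continuation (RootDecomp1KRadical04): §23g THE ENGINE radical_aeval_ne_zero / algebraicIndependent_radical: no integer relation between ρ, y, e^{uρ} when y = e^u has finite transcendence type and ρ > 0 is hyper-Liouville

Part of the six-file split (400-line rule) of lens 6's gen-11 node «RADICAL CELLS» = HOME/decomp-schanuel-lens-6/g11/addendum/RadicalCells.lean (sha256 16cddffc…, 2182 l;
1K ROUND 8 THEOREM ROUND, PATH T; critic VERDICT 2026-08-30T18:23:36Z ACCEPTED; census C-7bis; `--supports stmt-Schanuel-33363`). Port hygiene: the node's COPY blocks of §19/§21/§22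
declarations are NOT re-declared — they are the landed ones of Theorems/RootDecomp1KDark*/Torsion*/Kummer* (opened by name); twins of private/foreign tree lemmas are private here.
All parts share the namespace `Summit.Schanuel.Schanuel.Theorems.RootDecomp1KRadical`; the node docstring is in part 01. Sorry-free; standard axioms. Nothing here proves Schanuel; rung 0.
-/

noncomputable section

open Complex IntermediateField Polynomial

namespace Summit.Schanuel.Schanuel.Theorems.RootDecomp1KRadical

open Summit.Schanuel.Schanuel.Theorems.RootDecomp1KHyper (len len_nonneg one_le_len abs_coeff_le_len)
open Summit.Schanuel.Schanuel.Theorems.RootDecomp1KHyper.HyperCell (norm_aeval_le_len_mul_pow conjFactor sliceAt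
  relHat resPoly eval_conjFactor eval_sliceAt natDegree_conjFactor_le coeff_conjFactor natDegree_sliceAt_le
  natDegree_relHat_le evC evC_apply evC_comp_C map_relHat_evC relLen relLen_nonneg eval_map_int
  isAlgebraic_of_aeval_int norm_multiset_map_prod_le multiset_map_prod_le torCo torG aeval_torG natDegree_torG_le
  coeff_torG torCo_cast_eq eval_conjFactor_torG torD coeff_torD torD_ne_zero coeff_torG_eq_torD denBound
  den_lt_denBound norm_mvaeval_le cP cP_nonneg one_le_cP abs_torCo_le abs_coeff_torG_le len_torG_le relLen_torG_le
  pow_le_exp_mul eta_lt_delta upper_exp algebraicIndependent_of_forall_int HyperLiouville.rat_mul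
  dvd_of_irreducible_of_common_root pair_bounds HyperLiouville.ne_ratCast HyperLiouville.ne_zero HyperLiouville.neg)

variable {K : ℕ}

open Summit.Schanuel.Schanuel.Theorems.RootDecomp1KHyper.HyperCell (HyperLiouville)
open Summit.Schanuel.Schanuel.Theorems.RootDecomp1KHyper (WMeasure SB SFset sb_of_algebraicIndependent
  mem_adjoin_SFset_I')

/-- `x ≤ Real.exp x`. -/
private theorem self_le_exp (x : ℝ) : x ≤ Real.exp x := by linarith [Real.add_one_le_exp x]

/-! ### 23g. THE ENGINE: no integer relation between `ρ, y, e^{uρ}` when `y = e^u` has finite transcendence type -/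

set_option maxHeartbeats 2000000 in
/-- **THE ENGINE (radical conjugates over a transcendental base).**  `y = e^u` of finite transcendence
type, `ρ > 0` hyper-Liouville: the numbers `ρ, y, e^{uρ}` satisfy no non-trivial integer polynomial
relation.  PROOF.  `P(ρ, y, E) = 0`, `E = e^{uρ}`, `y` transcendental (by its measure).  At a
super-approximant `p/q` of `ρ` put `w = e^{up/q}`: `w^q = y^p`.  The eliminant
`S(Y) = Res_W(W^q − Y^p, q^D P(p/q, Y, W)) ∈ ℤ[Y]` has `S(y) = ∏_{b^q = y^p} q^D P(p/q, y, b)` (§23b);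
the factor at `b = w` is `≤ Q^D Kl |ρ − p/q| < e^{A₁Q²} e^{−Q^m}`, the others `≤ Q^D B'`; NO factor
vanishes, by the function-field Kummer lemma over `ℚ(y)` (§23a: `deg_W < q`, `gcd(p,q) = 1`); so
`S ≠ 0`, and the measure of `y` (`deg S ≤ qK + Np`, `log H(S) ≤ c_H Q²` by Parseval, §23c) gives
`|S(y)| ≥ e^{−A₃Q^{2k}}`, `k = τ + 3`, `m = 2k + 1` — contradiction for `Q ≥ A₁ + A₃ + 1`. -/
theorem radical_aeval_ne_zero {u y : ℂ} (huy : cexp u = y) (hy : FiniteTranscendenceType y)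
    {ρ : ℝ} (hρ : HyperLiouville ρ) (hρ0 : 0 < ρ) (P : MvPolynomial (Fin 3) ℤ) (hP : P ≠ 0) :
    MvPolynomial.aeval ![(ρ : ℂ), y, cexp (u * (ρ : ℂ))] P ≠ 0 := by
  classical
  intro hP0
  obtain ⟨c, τ, hc, hall⟩ := hy
  have hytr : Transcendental ℚ y := FiniteTranscendenceType.transcendental ⟨c, τ, hc, hall⟩
  obtain ⟨k, hk⟩ : ∃ k : ℕ, k = τ + 3 := ⟨_, rfl⟩
  obtain ⟨m, hm⟩ : ∃ m : ℕ, m = 2 * k + 1 := ⟨_, rfl⟩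
  have hm7 : 7 ≤ m := by omega
  have hτk : τ ≤ k := by omega
  have hk1 : 1 ≤ k := by omega
  -- data of `P`
  have hsupp : P.support.Nonempty :=
    Finset.nonempty_iff_ne_empty.mpr fun h => hP (MvPolynomial.support_eq_empty.mp h)
  obtain ⟨s₀, hs₀⟩ := hsupp
  obtain ⟨D, hDdef⟩ : ∃ D : ℕ, D = P.support.sup (fun s => s 0) := ⟨_, rfl⟩
  obtain ⟨K, hKdef⟩ : ∃ K : ℕ, K = P.support.sup (fun s => s 1) := ⟨_, rfl⟩
  obtain ⟨N, hNdef⟩ : ∃ N : ℕ, N = P.support.sup (fun s => s 2) := ⟨_, rfl⟩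
  have hD : ∀ s ∈ P.support, s 0 ≤ D := fun s hs =>
    hDdef ▸ Finset.le_sup (f := fun s : Fin 3 →₀ ℕ => s 0) hs
  have hK : ∀ s ∈ P.support, s 1 ≤ K := fun s hs =>
    hKdef ▸ Finset.le_sup (f := fun s : Fin 3 →₀ ℕ => s 1) hs
  have hN : ∀ s ∈ P.support, s 2 ≤ N := fun s hs =>
    hNdef ▸ Finset.le_sup (f := fun s : Fin 3 →₀ ℕ => s 2) hs
  obtain ⟨Kl, δ₁, hKl0, hδ₁, hlip⟩ := exists_lipschitz_linF P u y ρ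
  have hFρ : linF P u y ρ = 0 := by rw [linF_eq_aeval]; exact hP0
  -- constants
  obtain ⟨R₂, hR₂⟩ : ∃ R₂ : ℝ, R₂ = Real.exp (‖y‖ * (|ρ| + 1)) := ⟨_, rfl⟩
  have hR₂1 : 1 ≤ R₂ := by
    rw [hR₂]; exact Real.one_le_exp (by positivity)
  have hR₂0 : 0 ≤ R₂ := by linarith
  obtain ⟨B, hB⟩ : ∃ B : ℝ, B = ∑ s ∈ P.support,
      ((|P.coeff s| : ℤ) : ℝ) * ((|ρ| + 1) ^ (s 0) * ‖y‖ ^ (s 1) * R₂ ^ (s 2)) := ⟨_, rfl⟩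
  have hB0 : 0 ≤ B := by
    rw [hB]; exact Finset.sum_nonneg fun s _ => by positivity
  obtain ⟨B', hB'⟩ : ∃ B' : ℝ, B' = max 1 B := ⟨_, rfl⟩
  have hB'1 : 1 ≤ B' := hB' ▸ le_max_left _ _
  have hBB' : B ≤ B' := hB' ▸ le_max_right _ _
  obtain ⟨A, hA⟩ : ∃ A : ℝ,
      A = ((K : ℝ) + 1) * (((N : ℝ) + 1) * ((cP P : ℝ) * (|ρ| + 2) ^ D)) := ⟨_, rfl⟩
  have hcP1 : (1 : ℝ) ≤ cP P := by exact_mod_cast one_le_cP hs₀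
  have hK0 : (0 : ℝ) ≤ K := Nat.cast_nonneg K
  have hN0 : (0 : ℝ) ≤ N := Nat.cast_nonneg N
  have hD0 : (0 : ℝ) ≤ D := Nat.cast_nonneg D
  have hA1 : 1 ≤ A := by
    rw [hA]
    have h3 : (1 : ℝ) ≤ (|ρ| + 2) ^ D := one_le_pow₀ (by linarith [abs_nonneg ρ])
    calc (1 : ℝ) = 1 * (1 * (1 * 1)) := by ring
      _ ≤ ((K : ℝ) + 1) * (((N : ℝ) + 1) * ((cP P : ℝ) * (|ρ| + 2) ^ D)) := by
          gcongr <;> linarith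
  have hA0 : 0 ≤ A := by linarith
  obtain ⟨A₁, hA₁⟩ : ∃ A₁ : ℝ, A₁ = 2 * D + B' + Kl + 1 := ⟨_, rfl⟩
  obtain ⟨cN, hcN⟩ : ∃ cN : ℝ, cN = (K : ℝ) + N * (|ρ| + 1) + 1 := ⟨_, rfl⟩
  obtain ⟨cH, hcH⟩ : ∃ cH : ℝ, cH = 5 + A + D := ⟨_, rfl⟩
  obtain ⟨A₃, hA₃⟩ : ∃ A₃ : ℝ, A₃ = c * (cH + cN) ^ k := ⟨_, rfl⟩
  have hA₁0 : 0 ≤ A₁ := by rw [hA₁]; linarith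
  have hNρ : 0 ≤ (N : ℝ) * (|ρ| + 1) := by positivity
  have hcN0 : 0 ≤ cN := by rw [hcN]; linarith
  have hcH0 : 0 ≤ cH := by rw [hcH]; linarith
  have hA₃0 : 0 ≤ A₃ := by rw [hA₃]; positivity
  -- threshold and the super-approximant
  obtain ⟨q₀, hq₀def⟩ : ∃ q₀ : ℕ, q₀ = max (max (max 3 (denBound (torD P (s₀ 1) (s₀ 2))))
      (max (N + 1) (⌈1 / δ₁⌉₊ + 1))) (max (⌈A₁ + A₃⌉₊ + 1) (⌈1 / ρ⌉₊ + 1)) := ⟨_, rfl⟩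
  obtain ⟨r, hden, hρr, hη⟩ := hρ (max m q₀)
  have hq₀q : q₀ ≤ r.den := le_trans (le_max_right _ _) hden
  have hqm : m ≤ max m q₀ := le_max_left _ _
  have hqden : denBound (torD P (s₀ 1) (s₀ 2)) ≤ r.den := by rw [hq₀def] at hq₀q; omega
  have hqN : N < r.den := by rw [hq₀def] at hq₀q; omega
  have hqδ : ⌈1 / δ₁⌉₊ + 1 ≤ r.den := by rw [hq₀def] at hq₀q; omega
  have hqA : ⌈A₁ + A₃⌉₊ + 1 ≤ r.den := by rw [hq₀def] at hq₀q; omega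
  have hqρ : ⌈1 / ρ⌉₊ + 1 ≤ r.den := by rw [hq₀def] at hq₀q; omega
  have hqpos : 0 < r.den := r.den_pos
  have hq0 : r.den ≠ 0 := r.den_nz
  obtain ⟨Q, hQ⟩ : ∃ Q : ℝ, Q = (r.den : ℝ) := ⟨_, rfl⟩
  have hQ1 : (1 : ℝ) ≤ Q := by rw [hQ]; exact_mod_cast hqpos
  have hQ0 : (0 : ℝ) < Q := by linarith
  -- the approximation `η = |ρ − r|`
  obtain ⟨η, hηdef⟩ : ∃ η : ℝ, η = |ρ - r| := ⟨_, rfl⟩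
  rw [← hηdef, ← hQ] at hη
  have hη0 : 0 < η := by rw [hηdef]; exact abs_pos.mpr (sub_ne_zero.mpr hρr)
  have hηm : η < Real.exp (-(Q ^ m)) := by
    refine hη.trans_le (Real.exp_le_exp.mpr ?_)
    rw [neg_le_neg_iff]
    exact pow_le_pow_right₀ hQ1 hqm
  have hη7 : η < Real.exp (-(Q ^ 7)) := eta_lt_exp_neg_pow_of_le hQ1 hm7 hηm
  have hη1 : η < 1 := by
    refine hη7.trans_le ?_
    rw [← Real.exp_zero]
    exact Real.exp_le_exp.mpr (by rw [neg_nonpos]; positivity)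
  have hηδ : η < δ₁ := eta_lt_delta hQ1 hδ₁ (by rw [hQ]; exact_mod_cast hqδ) hη7
  have hηρ : η < ρ := eta_lt_delta hQ1 hρ0 (by rw [hQ]; exact_mod_cast hqρ) hη7
  -- `r > 0`, numerator `p = pn > 0` coprime to `q`
  have hr0 : (0 : ℝ) < r := by
    have : ρ - r ≤ η := by rw [hηdef]; exact le_abs_self _
    linarith
  have hr0' : 0 < r := by exact_mod_cast hr0
  have hnum0 : 0 < r.num := Rat.num_pos.mpr hr0'
  obtain ⟨pn, hpn⟩ : ∃ pn : ℕ, pn = r.num.natAbs := ⟨_, rfl⟩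
  have hpnZ : (pn : ℤ) = r.num := by rw [hpn]; exact Int.natAbs_of_nonneg hnum0.le
  have hcop : Nat.Coprime pn r.den := by rw [hpn]; exact r.reduced
  -- `|r| ≤ |ρ| + 1`, `p ≤ (|ρ| + 1) q`
  have hrabs : |(r : ℝ)| ≤ |ρ| + 1 := by
    have h1 : |(r : ℝ)| ≤ |ρ| + |ρ - r| := by
      have := abs_sub_abs_le_abs_sub (r : ℝ) ρ
      rw [abs_sub_comm] at this
      linarith
    rw [← hηdef] at h1
    linarith
  have hpabs : |(r.num : ℝ)| ≤ (|ρ| + 1) * Q := by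
    have e : (r : ℝ) = (r.num : ℝ) / (r.den : ℝ) := by exact_mod_cast (Rat.num_div_den r).symm
    have h := hrabs
    rw [e, abs_div, Nat.abs_cast, div_le_iff₀ (by exact_mod_cast hqpos : (0 : ℝ) < r.den), ← hQ] at h
    exact h
  have hpnQ : (pn : ℝ) ≤ (|ρ| + 1) * Q := by
    have : (pn : ℝ) = |(r.num : ℝ)| := by
      rw [hpn, Nat.cast_natAbs, Int.cast_abs]
    rw [this]; exact hpabs
  have hpn0 : (0 : ℝ) ≤ pn := Nat.cast_nonneg pn
  -- the radical polynomial `W^q − y^pn` and its complex roots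
  have hmem_roots : ∀ b : ℂ, b ∈ (X ^ r.den - C (y ^ pn) : ℂ[X]).roots ↔ b ^ r.den = y ^ pn :=
    fun b => mem_roots_kummer hqpos
  have hcard : Multiset.card (X ^ r.den - C (y ^ pn) : ℂ[X]).roots ≤ r.den :=
    card_roots_kummer_le r.den _
  -- norms of the roots
  have hR₂q : ‖y‖ ^ pn ≤ R₂ ^ r.den := by
    rw [hR₂, ← Real.exp_nat_mul]
    have h1 : ‖y‖ ^ pn ≤ Real.exp ‖y‖ ^ pn := pow_le_pow_left₀ (norm_nonneg _) (self_le_exp _) pn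
    rw [← Real.exp_nat_mul] at h1
    refine h1.trans (Real.exp_le_exp.mpr ?_)
    rw [← hQ]
    have h2 : (pn : ℝ) * ‖y‖ ≤ ((|ρ| + 1) * Q) * ‖y‖ :=
      mul_le_mul_of_nonneg_right hpnQ (norm_nonneg _)
    calc (pn : ℝ) * ‖y‖ ≤ ((|ρ| + 1) * Q) * ‖y‖ := h2
      _ = Q * (‖y‖ * (|ρ| + 1)) := by ring
  have hroot_norm : ∀ b ∈ (X ^ r.den - C (y ^ pn) : ℂ[X]).roots, ‖b‖ ≤ R₂ := by
    intro b hb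
    have hbq := (hmem_roots b).mp hb
    have h1 : ‖b‖ ^ r.den = ‖y‖ ^ pn := by
      have := congrArg norm hbq
      rwa [norm_pow, norm_pow] at this
    have h2 : ‖b‖ ^ r.den ≤ R₂ ^ r.den := h1 ▸ hR₂q
    exact (pow_le_pow_iff_left₀ (norm_nonneg _) hR₂0 hq0).mp h2
  -- the family `G`, its slice at `y`, and the eliminant `S`
  obtain ⟨G, hGdef⟩ : ∃ G : Fin (K + 1) → ℤ[X], G = torG P D r.num r.den K := ⟨_, rfl⟩
  have hGN : ∀ k, (G k).natDegree ≤ N := fun k =>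
    hGdef ▸ natDegree_torG_le P D r.num r.den K hN k
  obtain ⟨S, hSdef⟩ : ∃ S : ℤ[X], S = resY r.den pn G N := ⟨_, rfl⟩
  have hs₀K : s₀ 1 ≤ K := hK s₀ hs₀
  -- NON-VANISHING (§23a): the slice `F(y, W)` is a non-zero polynomial of degree `< q` over `ℚ(y)`
  have hslice0 : sliceAt G y ≠ 0 := by
    set k₀ : Fin (K + 1) := ⟨s₀ 1, Nat.lt_succ_of_le hs₀K⟩ with hk₀
    refine sliceAt_ne_zero_of_transcendental hytr G (k := k₀) (j := s₀ 2) ?_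
    intro hG
    have h1 := coeff_torG_eq_torD D r.num r.den hD hq0 k₀ (s₀ 2)
    rw [← hGdef, hG, Int.cast_zero, eq_comm, mul_eq_zero] at h1
    have hqQ : (r.den : ℚ) ^ D ≠ 0 := pow_ne_zero _ (by exact_mod_cast hq0)
    have h2 : aeval ((r.num : ℚ) / r.den) (torD P (s₀ 1) (s₀ 2)) = 0 := (or_iff_right hqQ).mp h1
    rw [Rat.num_div_den r] at h2
    have := den_lt_denBound (torD_ne_zero hs₀) h2
    omega
  have hfac_ne : ∀ b ∈ (X ^ r.den - C (y ^ pn) : ℂ[X]).roots, (conjFactor G b).eval y ≠ 0 := by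
    intro b hb
    rw [eval_conjFactor, ← eval_sliceAt]
    exact sliceAt_eval_ne_zero hytr hqpos hcop ((hmem_roots b).mp hb) G hGN hqN hslice0
  have hval : aeval y S =
      (((X ^ r.den - C (y ^ pn) : ℂ[X]).roots).map fun b => (conjFactor G b).eval y).prod := by
    rw [hSdef]; exact aeval_resY hqpos pn G hGN y
  have hSy0 : aeval y S ≠ 0 := by
    rw [hval]
    apply Multiset.prod_ne_zero
    intro hmem
    obtain ⟨b, hb, hb0⟩ := Multiset.mem_map.mp hmem
    exact hfac_ne b hb hb0
  have hS0 : S ≠ 0 := fun h => hSy0 (by rw [h, map_zero])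
  -- (L) the lower bound from the finite-type measure of `y`
  obtain ⟨N₁, hN₁⟩ : ∃ N₁ : ℕ, N₁ = r.den * K + N * pn + 1 := ⟨_, rfl⟩
  have hN₁1 : 1 ≤ N₁ := by omega
  have hdegS : S.natDegree ≤ N₁ := by
    rw [hSdef, hN₁]; exact (natDegree_resY_le r.den pn G N).trans (Nat.le_succ _)
  have hN₁Q : (N₁ : ℝ) ≤ cN * Q := by
    rw [hN₁, hcN]; push_cast; rw [← hQ]
    have h1 : (N : ℝ) * pn ≤ N * ((|ρ| + 1) * Q) := mul_le_mul_of_nonneg_left hpnQ hN0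
    nlinarith
  have hrelLen : relLen G ≤ A * Q ^ D := by
    rw [hGdef]
    refine (relLen_torG_le P D r.num r.den hD hN).trans ?_
    rw [hA, ← hQ]
    have h1 : (|(r.num : ℝ)| + Q) ^ D ≤ ((|ρ| + 2) * Q) ^ D := by
      apply pow_le_pow_left₀ (by positivity)
      nlinarith [abs_nonneg ρ]
    rw [mul_pow] at h1
    have hc0 : (0 : ℝ) ≤ (cP P : ℝ) := by linarith
    calc ((K : ℝ) + 1) * (((N : ℝ) + 1) * ((cP P : ℝ) * (|(r.num : ℝ)| + Q) ^ D))
        ≤ ((K : ℝ) + 1) * (((N : ℝ) + 1) * ((cP P : ℝ) * ((|ρ| + 2) ^ D * Q ^ D))) := by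
          gcongr
      _ = ((K : ℝ) + 1) * (((N : ℝ) + 1) * ((cP P : ℝ) * (|ρ| + 2) ^ D)) * Q ^ D := by
          ring
  have hAQ1 : 1 ≤ A * Q ^ D := one_le_mul_of_one_le_of_one_le hA1 (one_le_pow₀ hQ1)
  obtain ⟨T, hT⟩ : ∃ T : ℝ, T = (A * Q ^ D) ^ r.den := ⟨_, rfl⟩
  have hT1 : 1 ≤ T := hT ▸ one_le_pow₀ hAQ1
  obtain ⟨Hn, hHn⟩ : ∃ Hn : ℕ, Hn = max 16 ⌈T⌉₊ := ⟨_, rfl⟩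
  have hHn16 : 16 ≤ Hn := hHn ▸ le_max_left _ _
  have hHnT : T ≤ (Hn : ℝ) := by
    rw [hHn]; push_cast
    exact (Nat.le_ceil T).trans (by exact_mod_cast le_max_right _ _)
  have hHnle : (Hn : ℝ) ≤ 16 + (T + 1) := by
    rw [hHn]; push_cast
    refine max_le (by linarith) ?_
    linarith [Nat.ceil_lt_add_one (by linarith : (0 : ℝ) ≤ T)]
  have hcoefS : ∀ k, |S.coeff k| ≤ (Hn : ℤ) := by
    intro k
    have h1 : ((|S.coeff k| : ℤ) : ℝ) ≤ (max 1 (relLen G)) ^ r.den :=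
      hSdef ▸ abs_coeff_resY_le hqpos pn G hGN k
    have h2 : (max 1 (relLen G)) ^ r.den ≤ T :=
      hT ▸ pow_le_pow_left₀ (by positivity) (max_le hAQ1 hrelLen) _
    have h3 : ((|S.coeff k| : ℤ) : ℝ) ≤ ((Hn : ℤ) : ℝ) := by
      rw [Int.cast_natCast]; exact h1.trans (h2.trans hHnT)
    exact_mod_cast h3
  have hlow := hall S N₁ Hn hS0 hN₁1 hdegS hHn16 hcoefS
  -- (L') the exponent is at most `A₃ Q^{2k}`
  have hlogH : Real.log Hn ≤ cH * Q ^ 2 :=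
    hcH ▸ log_height_le hA1 hQ1 hQ.symm hT hHnle hHn16
  have hH16r : (16 : ℝ) ≤ Hn := by exact_mod_cast hHn16
  have hlogH0 : 0 ≤ Real.log Hn := Real.log_nonneg (by linarith)
  have hN₁r1 : (1 : ℝ) ≤ N₁ := by exact_mod_cast hN₁1
  have hE : c * ((N₁ : ℝ) + Real.log Hn) ^ τ ≤ A₃ * Q ^ (2 * k) := by
    rw [hA₃]; exact type_exponent_le hc.le hQ1 hN₁r1 hN₁Q hlogH0 hlogH hcN0 hcH0 hτk
  have hlow' : Real.exp (-(A₃ * Q ^ (2 * k))) ≤ ‖aeval y S‖ :=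
    le_trans (Real.exp_le_exp.mpr (by linarith)) hlow
  -- (U) the upper bound: the product over the radical conjugates
  obtain ⟨w, hw⟩ : ∃ w : ℂ, w = cexp (u * ((r : ℝ) : ℂ)) := ⟨_, rfl⟩
  have hwq : w ^ r.den = y ^ pn := by
    rw [hw, ← huy, ← Complex.exp_nat_mul, ← Complex.exp_nat_mul]
    congr 1
    have e1 : ((r.den : ℕ) : ℂ) * ((r : ℝ) : ℂ) = (pn : ℂ) := by
      have h := Rat.den_mul_eq_num r
      have h' : ((r.den : ℚ) : ℂ) * ((r : ℚ) : ℂ) = ((r.num : ℚ) : ℂ) := by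
        rw [← Rat.cast_mul, h]
      rw [Complex.ofReal_ratCast]
      rw [Rat.cast_natCast, Rat.cast_intCast] at h'
      rw [h', ← hpnZ, Int.cast_natCast]
    calc ((r.den : ℕ) : ℂ) * (u * ((r : ℝ) : ℂ)) = u * (((r.den : ℕ) : ℂ) * ((r : ℝ) : ℂ)) := by ring
      _ = (pn : ℂ) * u := by rw [e1, mul_comm]
  have hwmem : w ∈ (X ^ r.den - C (y ^ pn) : ℂ[X]).roots := (hmem_roots w).mpr hwq
  have hfac : ∀ b : ℂ, (conjFactor G b).eval y =
      (r.den : ℂ) ^ D * MvPolynomial.aeval ![((r.num : ℂ) / r.den), y, b] P := by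
    intro b; rw [hGdef]; exact eval_conjFactor_torG P D r.num r.den hD hK hq0 b _
  have hrC : ((r : ℝ) : ℂ) = (r.num : ℂ) / r.den := by
    rw [Complex.ofReal_ratCast, Rat.cast_def]
  have hnormq : ‖((r.den : ℂ)) ^ D‖ = Q ^ D := by rw [norm_pow, Complex.norm_natCast, hQ]
  -- the special factor
  have hwfac : ‖(conjFactor G w).eval y‖ ≤ Q ^ D * (Kl * η) := by
    rw [hfac w, norm_mul, hnormq]
    refine mul_le_mul_of_nonneg_left ?_ (by positivity)
    have e1 : MvPolynomial.aeval ![((r.num : ℂ) / r.den), y, w] P = linF P u y r := by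
      rw [linF_eq_aeval, hw, ← hrC]
    rw [e1, ← sub_zero (linF P u y r), ← hFρ]
    have h1 : |(r : ℝ) - ρ| < δ₁ := by rw [abs_sub_comm, ← hηdef]; exact hηδ
    have h2 := hlip r h1
    rw [abs_sub_comm, ← hηdef] at h2
    exact h2
  -- the other factors
  have hofac : ∀ b ∈ (X ^ r.den - C (y ^ pn) : ℂ[X]).roots,
      ‖(conjFactor G b).eval y‖ ≤ Q ^ D * B' := by
    intro b hb
    rw [hfac b, norm_mul, hnormq]
    refine mul_le_mul_of_nonneg_left (le_trans ?_ hBB') (by positivity)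
    rw [hB]
    refine norm_mvaeval_le P _ ?_ ?_ ?_
    · show ‖((r.num : ℂ) / r.den)‖ ≤ |ρ| + 1
      rw [← hrC, Complex.norm_real, Real.norm_eq_abs]; exact hrabs
    · show ‖y‖ ≤ ‖y‖
      exact le_rfl
    · show ‖b‖ ≤ R₂
      exact hroot_norm b hb
  have hQB1 : 1 ≤ Q ^ D * B' := one_le_mul_of_one_le_of_one_le (one_le_pow₀ hQ1) hB'1
  have hup : ‖aeval y S‖ ≤ (Q ^ D * B') ^ r.den * (Q ^ D * (Kl * η)) := by
    rw [hval, ← Multiset.cons_erase hwmem, Multiset.map_cons, Multiset.prod_cons, norm_mul, mul_comm]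
    refine mul_le_mul ?_ hwfac (norm_nonneg _) (by positivity)
    refine (norm_multiset_map_prod_le _ (by positivity) _ fun b hb =>
      hofac b (Multiset.mem_of_mem_erase hb)).trans ?_
    refine pow_le_pow_right₀ hQB1 ?_
    exact (Multiset.card_erase_le).trans hcard
  -- (U') at most `exp(A₁ Q²) η`
  have hup' : (Q ^ D * B') ^ r.den * (Q ^ D * (Kl * η)) ≤ Real.exp (A₁ * Q ^ 2) * η := by
    rw [hA₁]; exact upper_exp hQ.symm hQ1 hB'1 hKl0 hη0.le
  -- (E) endgame
  have hchain : Real.exp (-(A₃ * Q ^ (2 * k))) < Real.exp (A₁ * Q ^ 2) * Real.exp (-(Q ^ m)) := by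
    calc Real.exp (-(A₃ * Q ^ (2 * k))) ≤ ‖aeval y S‖ := hlow'
      _ ≤ (Q ^ D * B') ^ r.den * (Q ^ D * (Kl * η)) := hup
      _ ≤ Real.exp (A₁ * Q ^ 2) * η := hup'
      _ < Real.exp (A₁ * Q ^ 2) * Real.exp (-(Q ^ m)) :=
          mul_lt_mul_of_pos_left hηm (Real.exp_pos _)
  rw [← Real.exp_add, Real.exp_lt_exp] at hchain
  have hQA : A₁ + A₃ + 1 ≤ Q := by
    have hc : (⌈A₁ + A₃⌉₊ : ℝ) + 1 ≤ Q := by rw [hQ]; exact_mod_cast hqA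
    linarith [Nat.le_ceil (A₁ + A₃)]
  exact endgame_type hQ1 hA₁0 hA₃0 hQA hk1 hm hchain

/-- **The engine, algebraic form**: `ρ, y, e^{uρ}` are algebraically independent over `ℚ`
(`y = e^u` of finite transcendence type, `ρ > 0` hyper-Liouville). -/
theorem algebraicIndependent_radical {u y : ℂ} (huy : cexp u = y) (hy : FiniteTranscendenceType y)
    {ρ : ℝ} (hρ : HyperLiouville ρ) (hρ0 : 0 < ρ) :
    AlgebraicIndependent ℚ ![(ρ : ℂ), y, cexp (u * (ρ : ℂ))] :=
  algebraicIndependent_of_forall_int fun G hG => radical_aeval_ne_zero huy hy hρ hρ0 G hG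

end Summit.Schanuel.Schanuel.Theorems.RootDecomp1KRadical
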